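import Summits.Schanuel.Schanuel.Theorems.RootDecomp1BDefectFloorCells
import Summits.Schanuel.Schanuel.Theorems.RootDecomp1KHyper18
import Summits.Schanuel.Schanuel.Theorems.RootDecomp1KHyperDense
import Mathlib.Analysis.SpecificLimits.Basic
import Mathlib.Analysis.Complex.ExponentialBounds
import Mathlib.Algebra.BigOperators.Field
import Mathlib.Data.Rat.Lemmas
import Mathlib.Data.Nat.Prime.Basic

/-!
# RootDecomp1BRadicalDescent — lens 4, generations 30–31 «RADICAL DESCENT / STOREY-TWO CELLS» (RadicalDescent.lean g31 47a8f674…, 1887 l) — part 1 (RootDecomp1BRadicalDescent01): §A formal algebra — `powSubst`, `psi`, `QDiv`, the residue lemma, the norm-form matrix `radMat`, `det_radMat_ne_zero`, `det_eq_eigen_mul`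

PORT NOTE (census-1 gen 15, 2026-08-31): port of HOME/decomp-schanuel-lens-4/g31/RadicalDescent.lean (sha256 47a8f674…751d, 1887 l; §A–§F
byte-identical to g30 5c3146f4…; own farm rc 0 · 0 warn · 0 sorry · axioms std; critic VERDICT STATUS L1626 (B-R17 (b)/B-R18 X(2) cell MET;
(d) PORT GO LOW, kernel recommended), SOURCE UPDATE L1648) in SIX parts `RootDecomp1BRadicalDescent01`–`06`: 01 = §A formal algebra,
02 = §B sizes + §C ultra-Liouville reals, 03 = §D prerequisites (+ the extracted private lemma `clash_ineq`), 04 = §D KERNEL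
`algebraicIndependent_radical`, 05 = §E cells + §F column, 06 = §G named member `ρ_U` + named cells. The two `set_option linter.*`
lines dropped; `import …Theses.RootDecomp1B` confined to part 06, where the three LIVE-LINK theorems now sit (the §E/§F links moved there); 58 one-line
docstrings added; fourteen generic one-liners (`mvlen_*` helpers, `intCast_eq_C`, `pow_le_exp_mul`, `natCast_le_exp`) made `private`
with per-part private copies; ONE structural edit forced by the 400-line cap: the kernel's final 52-line real-inequality step
«(5) the clash» is the private lemma `clash_ineq` (part 03), called on the kernel's last line — everything else verbatim.
`--supports stmt-Schanuel-24622`; no census credit. Nothing here proves Schanuel; rung 0. The lens's header follows.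
-/

/-!
# RadicalDescent — decomp-schanuel lens 4 (minimal-counterexample / extremal reduction), generation 30 (+ §G, generation 31)

Unit `decomp-schanuel-lens-4-g30` · 2026-08-31 · HOME `decomp-schanuel-lens-4/g30/RadicalDescent.lean`;
§G (named member `ρ_U`, VARIANT bookkeeping) added by unit `decomp-schanuel-lens-4-g31` · HOME `decomp-schanuel-lens-4/g31/RadicalDescent.lean`
(§A–§F byte-identical to the g30 file).
RUNG 0: nothing in this file proves Schanuel's conjecture or the crux; route-Schanuel-RootDecomp1B (DRAFT rev 32,
15/15 items) is UNCHANGED by this generation (no item / split / kind / closes / residual change; no ledger write).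

NODE OF RECORD.  `_root_.Schanuel` ⟸ X = `Summit.Schanuel.Schanuel.Theses.RootDecomp1B.KleinPolarSchanuel`
(stmt-Schanuel-24622: `∀ m (r : Fin m → ℝ), LinearIndependent ℚ r → m + m ≤ t(r)`,
`t(r) = polarDeg r = trdeg_ℚ ℚ(r, ir, e^r, e^{ir})`) ⟸ the seven analytic items of rev 32.

WHAT THIS FILE DECIDES (mod ONE binder `hLW : RootDecomp1KHyper.LWMeasure` = Ably's Lindemann–Weierstrass measure,
the lens-6 convention of gen 29; the kernel theorem itself is hypothesis-free given its measure predicate):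

* §E  **X(2) AT (1, ρ)** for EVERY ultra-Liouville real `ρ` (`|ρ − p/q| < exp(−exp(q^m))` for all `m`; a dense
  `G_δ` class, `dense_setOf_ultraLiouville`, hypothesis-free): `t(1, ρ) ≥ 4 = m + m` (`m = 2`) —
  `four_le_polarDeg_one_ultra`, verbatim crux-body shape `kleinPolarSchanuel_body_two_one_ultra`, live link
  `kleinPolarSchanuel_instance_shape` (`= hX 2 ![1, ρ] _`: the cell IS the `m = 2` instance of item 24622),
  `(1, ρ)` certified `ℚ`-free (`linearIndependent_one_of_irrational`), flagship `exists_storey_two_cell`,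
  `dense_storey_two_cells`; underlying independence `algebraicIndependent_four_of_pos`: `(e^{ρ}, ρ, e, e^{i})`
  algebraically independent.  Pointwise step instances at `(1 | ρ)` of items 32408 / 32407 / 32406:
  `wildSharpDefectZeroAt_one_ultra`, `wildSharpDefectZeroInitAt_one_ultra`, `tameDefectZeroAt_one_ultra`,
  `sharpRelativeLindemannAt_one_ultra`; 1K rider `hyperLiouvilleSchanuel_instance_one_ultra` (item 33363, n = 4 shape).
* §F  **THE COLUMN AT EVERY STOREY: X(m+1) AT (β | β_{j₀} ρ)**, `β ∈ (ℚ̄ ∩ ℝ)^m` `ℚ`-free, `ρ` ultra-Liouville: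
  `t(β | β_{j₀} ρ) ≥ (m+1) + (m+1)` — `polarDeg_snoc_ultra`, `ℚ`-free certified `linearIndependent_snoc_mul_ultra`,
  body / live-link / W0 / W0Init / T0 / SRL `…_column_ultra`.  This upgrades gen 29's coordinate column
  (`RootDecomp1BSRLLogLiouville.floor_snoc_liouville`: the FLOOR `t ≥ 2m+1`, λ Liouville) to X itself on the
  ultra-Liouville sub-column.
* §D  **KERNEL (radical / Kummer descent)** `algebraicIndependent_radical`: `DExpMeasure θ` (§B: a measure of
  algebraic independence UNIFORM in the degree, doubly exponential in it; supplied for `θ = e^{y}`, `y` algebraic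
  `ℚ`-free, by `dExpMeasure_exp_of_LW hLW`), `e^{y₀} = θ_{i₀}`, `ρ > 0` ultra-Liouville ⟹
  `(e^{ρ y₀}, ρ, θ_1, …, θ_n)` algebraically independent.  §A: the norm form of the radical `T^q − X_{i₀}` over
  `ℤ[X]` (`radMat`, formal non-vanishing `det_radMat_ne_zero`, eigen-identity `det_eq_eigen_mul`); §B: sizes;
  §C: ultra-Liouville reals (dense `G_δ`, `exists_pos_ultraLiouville`).

`lean check`: rc 0 · 0 errors · 0 warnings · 0 sorries; `#print axioms` of `algebraicIndependent_radical` and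
`exists_storey_two_cell` = {propext, Classical.choice, Quot.sound}.  Imports: tree modules only
(`…Theorems.RootDecomp1BDefectFloorCells`, `…RootDecomp1KHyper18`, `…RootDecomp1KHyperDense`; `…Theses.RootDecomp1B`
solely for the two `…_shape` live links).
-/

noncomputable section

open Complex

namespace Summit.Schanuel.Schanuel.Theorems.RootDecomp1BRadicalDescent

/-! ## §A FORMAL ALGEBRA: the norm form of the radical `T^q − X_{i₀}` over `ℤ[X]` -/

section Formal

open MvPolynomial

variable {n : ℕ}

/-- The residue of `x` mod `q`, as an element of `Fin q`. -/
def resFin {q : ℕ} (hq : 0 < q) (x : ℕ) : Fin q := ⟨x % q, Nat.mod_lt x hq⟩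

/-- The value of `resFin hq x` is `x % q`. -/
@[simp] theorem resFin_val {q : ℕ} (hq : 0 < q) (x : ℕ) : (resFin hq x : ℕ) = x % q := rfl

/-- **The fibre sum.** If `w ^ q = t` then the "multiplication-by-`Σ_k c_k T^{pk}` matrix modulo
`T^q − t`" (row `l`, columns `a`, entries `Σ_{(pk+l) % q = a} c_k t^{(pk+l)/q}`) has `(w^a)_a` as an
eigenvector with eigenvalue `Σ_k c_k w^{pk}`. One lemma serves the formal identity over `ℤ[X]` and the
evaluated one over `ℂ`. -/
theorem fiber_sum {S : Type*} [CommSemiring S] {q : ℕ} (hq : 0 < q) (K p : ℕ) (c : ℕ → S)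
    (t w : S) (hw : w ^ q = t) (l : Fin q) :
    ∑ a : Fin q, (∑ k ∈ (Finset.range (K + 1)).filter (fun k => resFin hq (p * k + l) = a),
        c k * t ^ ((p * k + l) / q)) * w ^ (a : ℕ) =
      (∑ k ∈ Finset.range (K + 1), c k * w ^ (p * k)) * w ^ (l : ℕ) := by
  have step1 : ∀ a : Fin q,
      (∑ k ∈ (Finset.range (K + 1)).filter (fun k => resFin hq (p * k + l) = a),
        c k * t ^ ((p * k + l) / q)) * w ^ (a : ℕ) =
      ∑ k ∈ (Finset.range (K + 1)).filter (fun k => resFin hq (p * k + l) = a),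
        c k * w ^ (p * k + l) := by
    intro a
    rw [Finset.sum_mul]
    refine Finset.sum_congr rfl fun k hk => ?_
    have hka : resFin hq (p * k + l) = a := (Finset.mem_filter.1 hk).2
    have hav : (a : ℕ) = (p * k + l) % q := by rw [← hka]; rfl
    rw [← hw, ← pow_mul, mul_assoc, ← pow_add, hav, Nat.div_add_mod]
  rw [Finset.sum_congr rfl fun a _ => step1 a,
    Finset.sum_fiberwise_of_maps_to (fun k _ => Finset.mem_univ _), Finset.sum_mul]
  refine Finset.sum_congr rfl fun k _ => ?_
  rw [pow_add, mul_assoc]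

variable (i₀ : Fin n) (q : ℕ)

/-- The substitution `X_{i₀} ↦ X_{i₀}^q` (identity on the other variables). -/
def powSubst : MvPolynomial (Fin n) ℤ →ₐ[ℤ] MvPolynomial (Fin n) ℤ :=
  bind₁ fun j => if j = i₀ then X i₀ ^ q else X j

/-- The exponent map of `powSubst`. -/
def psi (m : Fin n →₀ ℕ) : Fin n →₀ ℕ := m.update i₀ (q * m i₀)

/-- `psi i₀ q m` multiplies the `i₀`-exponent by `q` and keeps the others. -/
theorem psi_apply (m : Fin n →₀ ℕ) (j : Fin n) :
    psi i₀ q m j = if j = i₀ then q * m i₀ else m j := by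
  classical
  simp [psi, Finsupp.update_apply]

/-- The `i₀`-exponent of `psi i₀ q m` is `q · m i₀`. -/
theorem psi_apply_self (m : Fin n →₀ ℕ) : psi i₀ q m i₀ = q * m i₀ := by
  simp [psi_apply]

/-- `powSubst` on variables: `X_{i₀} ↦ X_{i₀}^q`, `X_j ↦ X_j` otherwise. -/
theorem powSubst_X (j : Fin n) :
    powSubst i₀ q (X j) = if j = i₀ then X i₀ ^ q else X j := by
  simp [powSubst, bind₁_X_right]

/-- `powSubst i₀ q (X i₀) = X i₀ ^ q`. -/
theorem powSubst_X_self : powSubst i₀ q (X i₀) = X i₀ ^ q := by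
  simp [powSubst_X]

/-- `powSubst` maps the monomial `c · x^m` to `c · x^{psi m}`. -/
theorem powSubst_monomial (m : Fin n →₀ ℕ) (c : ℤ) :
    powSubst i₀ q (monomial m c) = monomial (psi i₀ q m) c := by
  classical
  rw [powSubst, bind₁_monomial, monomial_eq]
  congr 1
  change (m.prod fun i e => (if i = i₀ then X i₀ ^ q else X i) ^ e) = _
  rw [Finsupp.prod_fintype _ _ (fun i => by simp), Finsupp.prod_fintype _ _ (fun i => by simp)]
  refine Finset.prod_congr rfl fun j _ => ?_
  rw [psi_apply]
  split_ifs with h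
  · subst h; rw [← pow_mul]
  · rfl

/-- The exponent map `psi i₀ q` is injective for `q > 0`. -/
theorem psi_injective (hq : 0 < q) : Function.Injective (psi i₀ q) := by
  intro m m' h
  ext j
  have hj := congrArg (fun f : Fin n →₀ ℕ => f j) h
  simp only [psi_apply] at hj
  by_cases hji : j = i₀
  · subst hji
    simp only [if_true] at hj
    exact Nat.eq_of_mul_eq_mul_left hq hj
  · simpa [hji] using hj

/-- `powSubst P` as the sum of the substituted monomials of `P`. -/
theorem powSubst_eq_sum (P : MvPolynomial (Fin n) ℤ) :
    powSubst i₀ q P = ∑ m ∈ P.support, monomial (psi i₀ q m) (P.coeff m) := by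
  conv_lhs => rw [P.as_sum]
  rw [map_sum]
  exact Finset.sum_congr rfl fun m _ => powSubst_monomial i₀ q m _

/-- The coefficient of `powSubst P` at `psi m` is the coefficient of `P` at `m` (`q > 0`). -/
theorem coeff_powSubst_psi (hq : 0 < q) (P : MvPolynomial (Fin n) ℤ) (m : Fin n →₀ ℕ) :
    (powSubst i₀ q P).coeff (psi i₀ q m) = P.coeff m := by
  classical
  rw [powSubst_eq_sum, coeff_sum]
  simp_rw [coeff_monomial]
  rw [Finset.sum_eq_single m]
  · rw [if_pos rfl]
  · intro m' _ hm'
    rw [if_neg]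
    exact fun h => hm' (psi_injective i₀ q hq h)
  · intro hm
    rw [if_pos rfl]
    exact notMem_support_iff.1 hm

/-- `powSubst i₀ q` is injective for `q > 0`. -/
theorem powSubst_injective (hq : 0 < q) : Function.Injective (powSubst i₀ q) := by
  intro P Q h
  ext m
  rw [← coeff_powSubst_psi i₀ q hq P m, ← coeff_powSubst_psi i₀ q hq Q m, h]

/-- `powSubst i₀ q P = 0 ↔ P = 0` for `q > 0`. -/
theorem powSubst_eq_zero_iff (hq : 0 < q) (P : MvPolynomial (Fin n) ℤ) :
    powSubst i₀ q P = 0 ↔ P = 0 :=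
  ⟨fun h => powSubst_injective i₀ q hq (by rw [h, map_zero]), fun h => by rw [h, map_zero]⟩

/-- "every monomial has `i₀`-exponent divisible by `q`". -/
def QDiv (g : MvPolynomial (Fin n) ℤ) : Prop := ∀ m ∈ g.support, q ∣ m i₀

/-- Every monomial of `powSubst i₀ q P` has `i₀`-exponent divisible by `q`. -/
theorem qdiv_powSubst (P : MvPolynomial (Fin n) ℤ) : QDiv i₀ q (powSubst i₀ q P) := by
  classical
  intro m hm
  rw [powSubst_eq_sum] at hm
  obtain ⟨m', -, hm'⟩ := Finset.mem_biUnion.1 (support_sum hm)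
  have hmm : m = psi i₀ q m' := by
    simpa using support_monomial_subset hm'
  rw [hmm, psi_apply_self]
  exact dvd_mul_right q _

/-- **Residue lemma.** A sum `Σ_k g_k · X_{i₀}^{e_k}` with every `g_k` having all `i₀`-exponents
`≡ 0 (mod q)` and the `e_k` pairwise distinct mod `q` vanishes only if every `g_k` does. -/
theorem residue_lemma {ι : Type*} (_hq : 0 < q) (S : Finset ι) (g : ι → MvPolynomial (Fin n) ℤ)
    (e : ι → ℕ) (hg : ∀ k ∈ S, QDiv i₀ q (g k))
    (he : ∀ k ∈ S, ∀ k' ∈ S, e k % q = e k' % q → k = k')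
    (h0 : ∑ k ∈ S, g k * X i₀ ^ e k = 0) : ∀ k ∈ S, g k = 0 := by
  classical
  intro k hk
  by_contra hne
  obtain ⟨m₀, hm₀⟩ := MvPolynomial.ne_zero_iff.1 hne
  have hdiv : q ∣ m₀ i₀ := hg k hk m₀ (mem_support_iff.2 hm₀)
  set m : Fin n →₀ ℕ := m₀ + Finsupp.single i₀ (e k) with hm
  have hterm : ∀ k' ∈ S, (g k' * X i₀ ^ e k').coeff m =
      if k' = k then (g k).coeff m₀ else 0 := by
    intro k' hk'
    rw [X_pow_eq_monomial, coeff_mul_monomial', mul_one]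
    by_cases hkk : k' = k
    · rw [hkk, if_pos (Finsupp.single_le_iff.2 (by simp [hm])), if_pos rfl, hm, add_tsub_cancel_right]
    · rw [if_neg hkk]
      split_ifs with hle
      · by_contra hc
        have hsupp : m - Finsupp.single i₀ (e k') ∈ (g k').support := mem_support_iff.2 hc
        have hd' := hg k' hk' _ hsupp
        simp only [hm, Finsupp.tsub_apply, Finsupp.add_apply, Finsupp.single_eq_same] at hd'
        have hle' : e k' ≤ m₀ i₀ + e k := by
          have := Finsupp.single_le_iff.1 hle
          simpa [hm] using this
        apply hkk
        apply he k' hk' k hk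
        obtain ⟨d, hd⟩ := hdiv
        obtain ⟨t, ht⟩ := hd'
        have h1 : m₀ i₀ + e k = q * t + e k' := by omega
        have hA : (m₀ i₀ + e k) % q = e k % q := by rw [hd, Nat.mul_add_mod]
        have hB : (m₀ i₀ + e k) % q = e k' % q := by rw [h1, Nat.mul_add_mod]
        exact hB.symm.trans hA
      · rfl
  have hsum : (∑ k' ∈ S, g k' * X i₀ ^ e k').coeff m = (g k).coeff m₀ := by
    rw [coeff_sum, Finset.sum_congr rfl hterm, Finset.sum_ite_eq' S k, if_pos hk]
  rw [h0, coeff_zero] at hsum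
  exact hm₀ hsum.symm

/-- **The norm-form matrix.** Row `l`, column `a`: `Σ_{k ≤ K, (pk+l) % q = a} C_k · X_{i₀}^{(pk+l)/q}`
— the matrix of multiplication by `Σ_k C_k T^{pk}` on `ℤ[X][T]/(T^q − X_{i₀})` in the basis `T^l`. -/
def radMat (Cf : ℕ → MvPolynomial (Fin n) ℤ) (K p : ℕ) {q : ℕ} (hq : 0 < q) (i₀ : Fin n) :
    Matrix (Fin q) (Fin q) (MvPolynomial (Fin n) ℤ) :=
  fun l a => ∑ k ∈ (Finset.range (K + 1)).filter (fun k => resFin hq (p * k + l) = a),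
    Cf k * X i₀ ^ ((p * k + l) / q)

/-- `powSubst` applied to an entry of the norm-form matrix `radMat`: the fibre sum over `k ≤ K` with `(pk+l) % q = a`. -/
theorem powSubst_radMat (Cf : ℕ → MvPolynomial (Fin n) ℤ) (K p : ℕ) (hq : 0 < q) (l a : Fin q) :
    powSubst i₀ q (radMat Cf K p hq i₀ l a) =
      ∑ k ∈ (Finset.range (K + 1)).filter (fun k => resFin hq (p * k + l) = a),
        powSubst i₀ q (Cf k) * (X i₀ ^ q) ^ ((p * k + l) / q) := by
  simp only [radMat, map_sum, map_mul, map_pow, powSubst_X_self]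

/-- **Formal non-vanishing of the norm form.** For `K < q`, `gcd(p,q) = 1` and some `C_k ≠ 0`
(`k ≤ K`), `det (radMat) ≠ 0` in `ℤ[X]`: a kernel vector `v` would give
`(Σ_l φ(v_l) X^l)(Σ_k φ(C_k) X^{pk}) = 0` under `φ : X_{i₀} ↦ X_{i₀}^q`, and the residue lemma kills
both factors' coefficients. -/
theorem det_radMat_ne_zero (Cf : ℕ → MvPolynomial (Fin n) ℤ) {K p : ℕ} (hq : 0 < q)
    (hKq : K < q) (hpq : Nat.Coprime p q) (hC : ∃ k ≤ K, Cf k ≠ 0) :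
    (radMat Cf K p hq i₀).det ≠ 0 := by
  classical
  rw [Ne, ← Matrix.exists_vecMul_eq_zero_iff]
  rintro ⟨v, hv0, hv⟩
  apply hv0
  set Ψ : MvPolynomial (Fin n) ℤ :=
    ∑ k ∈ Finset.range (K + 1), powSubst i₀ q (Cf k) * X i₀ ^ (p * k) with hΨ
  set V : MvPolynomial (Fin n) ℤ := ∑ l : Fin q, powSubst i₀ q (v l) * X i₀ ^ (l : ℕ) with hV
  have hrow : ∀ l : Fin q,
      ∑ a : Fin q, powSubst i₀ q (radMat Cf K p hq i₀ l a) * X i₀ ^ (a : ℕ) = Ψ * X i₀ ^ (l : ℕ) := by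
    intro l
    simp_rw [powSubst_radMat]
    exact fiber_sum hq K p (fun k => powSubst i₀ q (Cf k)) (X i₀ ^ q) (X i₀) rfl l
  have h1 : ∀ a : Fin q, powSubst i₀ q ((Matrix.vecMul v (radMat Cf K p hq i₀)) a) = 0 := fun a => by
    rw [hv]; simp
  have hVΨ : V * Ψ = 0 := by
    calc V * Ψ = ∑ l : Fin q, powSubst i₀ q (v l) * (Ψ * X i₀ ^ (l : ℕ)) := by
          rw [hV, Finset.sum_mul]
          exact Finset.sum_congr rfl fun l _ => by ring
      _ = ∑ l : Fin q, powSubst i₀ q (v l) *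
            ∑ a : Fin q, powSubst i₀ q (radMat Cf K p hq i₀ l a) * X i₀ ^ (a : ℕ) := by
          simp_rw [hrow]
      _ = ∑ a : Fin q, powSubst i₀ q ((Matrix.vecMul v (radMat Cf K p hq i₀)) a) * X i₀ ^ (a : ℕ) := by
          simp only [Matrix.vecMul, dotProduct, map_sum, map_mul, Finset.mul_sum, Finset.sum_mul]
          rw [Finset.sum_comm]
          exact Finset.sum_congr rfl fun a _ => Finset.sum_congr rfl fun l _ => by ring
      _ = 0 := by simp [h1]
  have hΨ0 : Ψ ≠ 0 := by
    intro hΨz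
    obtain ⟨k₀, hk₀, hCk₀⟩ := hC
    have hres := residue_lemma i₀ q hq (Finset.range (K + 1)) (fun k => powSubst i₀ q (Cf k))
      (fun k => p * k) (fun k _ => qdiv_powSubst i₀ q (Cf k)) ?_ hΨz k₀
      (Finset.mem_range.2 (Nat.lt_succ_of_le hk₀))
    · exact hCk₀ ((powSubst_eq_zero_iff i₀ q hq _).1 hres)
    · intro k hk k' hk' hkk
      have hk1 : k < q := lt_of_lt_of_le (Finset.mem_range.1 hk) hKq
      have hk1' : k' < q := lt_of_lt_of_le (Finset.mem_range.1 hk') hKq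
      have hmod : p * k ≡ p * k' [MOD q] := hkk
      exact Nat.ModEq.eq_of_lt_of_lt (Nat.ModEq.cancel_left_of_coprime hpq.symm hmod) hk1 hk1'
  have hV0 : V = 0 := (mul_eq_zero.1 hVΨ).resolve_right hΨ0
  have hres := residue_lemma i₀ q hq (Finset.univ : Finset (Fin q)) (fun l => powSubst i₀ q (v l))
    (fun l => (l : ℕ)) (fun l _ => qdiv_powSubst i₀ q (v l)) ?_ hV0
  · funext l
    exact (powSubst_eq_zero_iff i₀ q hq _).1 (hres l (Finset.mem_univ l))
  · intro l _ l' _ hll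
    rw [Nat.mod_eq_of_lt l.isLt, Nat.mod_eq_of_lt l'.isLt] at hll
    exact Fin.ext hll

/-- **Norm factorisation (evaluated).** If `w^q = t` and `Mθ` is the evaluated norm-form matrix, then
`det Mθ = (Σ_k c_k w^{pk}) · Σ_a adj(Mθ)_{0a} w^a` (adjugate identity on the eigenvector `(w^a)_a`). -/
theorem det_eq_eigen_mul {q : ℕ} (hq : 0 < q) (K p : ℕ) (c : ℕ → ℂ) (t w : ℂ) (hw : w ^ q = t)
    (Mθ : Matrix (Fin q) (Fin q) ℂ)
    (hM : ∀ l a, Mθ l a = ∑ k ∈ (Finset.range (K + 1)).filter (fun k => resFin hq (p * k + l) = a),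
      c k * t ^ ((p * k + l) / q)) :
    Mθ.det = (∑ k ∈ Finset.range (K + 1), c k * w ^ (p * k)) *
      ∑ a : Fin q, Mθ.adjugate ⟨0, hq⟩ a * w ^ (a : ℕ) := by
  classical
  set vw : Fin q → ℂ := fun a => w ^ (a : ℕ) with hvw
  set Φ : ℂ := ∑ k ∈ Finset.range (K + 1), c k * w ^ (p * k) with hΦ
  have heig : Mθ.mulVec vw = Φ • vw := by
    funext l
    simp only [Matrix.mulVec, dotProduct, Pi.smul_apply, smul_eq_mul, hvw]
    rw [Finset.sum_congr rfl fun a _ => by rw [hM l a], fiber_sum hq K p c t w hw l]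
  have h2 : Mθ.adjugate.mulVec (Mθ.mulVec vw) = Mθ.det • vw := by
    rw [Matrix.mulVec_mulVec, Matrix.adjugate_mul, Matrix.smul_mulVec, Matrix.one_mulVec]
  have h3 : Mθ.det • vw = Φ • (Mθ.adjugate.mulVec vw) := by
    rw [← h2, heig, Matrix.mulVec_smul]
  have h4 := congrFun h3 ⟨0, hq⟩
  simp only [Pi.smul_apply, smul_eq_mul, Matrix.mulVec, dotProduct, hvw, pow_zero, mul_one] at h4
  rw [h4]

end Formal

end Summit.Schanuel.Schanuel.Theorems.RootDecomp1BRadicalDescent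

end
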